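import Summits.AtomisticToContinuum.BoseEinsteinCondensation.Theorems.BECThomsonPrincipleGDTransferSeededWitnessDefs
import Summits.AtomisticToContinuum.BoseEinsteinCondensation.Theorems.BECThomsonPrincipleGDTransferBareAdmissible
import Summits.AtomisticToContinuum.BoseEinsteinCondensation.Theorems.BECThomsonPrincipleGDTransferSeededProjectedDichotomyPlainPair

/-!
# Route `BECThomsonPrinciple`, crux `GDTransfer` (stmt-AtomisticToContinuum-9482), line `seeded-continuity`:
# stub `stub_plainPairAlgebra`, part 1 — (A1) the plain pair are directions, (A2) their a-priori budgets

Support file of the registered stub `stub_plainPairAlgebra` (`LNSSAlgebra → PlainPairAlgebra ∧ PlainKineticIdentity`).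
For the PLAIN witness pair of `…SeededWitnessDefs`,
`plainUp m L n g = N^{-1/2} Σ_i e_n(x_i)·P_i g` (`ζ₊ = N^{-1/2} a_n†a₀ g`) and
`plainDown m L n g = N^{-1/2} Σ_i P_i^{(n)} g` (`ζ₋ = N^{-1/2} a₀†a_n g`):
* (A1) both are variation directions for every direction `g` — the landed `PlainPair.isDirection_upB/dnB`
  and closure of directions under scalars (`ChordVariation.dir_const_mul`);
* (A2) the BUDGET `A𝓔 + B‖·‖²` (`A ≤ B`, `A‖n‖² ≤ B`) of `ζ±` is at most `2^N·N·(2 + 6N(2π/L)²)(1 + κ)` times that of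
  `g`, `κ ≥ N²L⁻³‖v‖₁` (landed toolkit `Bare.budget_smul_le / budget_finset_sum_le / budget_phase_le /
  budget_cellAvg_le / budget_sum_fourierAvg_le`; the scalar `N^{-1/2}` has modulus `≤ 1`), whence for a finite
  continuous profile (`∫ v < ∞`, `lintegral_ne_top_of_isFiniteContinuous`) one radius `R₀ = R₀(v, N, L)` with
  `‖ζ±‖² ≤ R₀` and `𝓔(ζ±) ≤ R₀(1 + ‖n‖²)(E(Ψ) + 1)` for every mode `n` and every periodic trial state `Ψ`
  (`plainPair_apriori`, verbatim the first half of the landed `stub_bareAdmissible` with the plain pair).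
All [folklore] (KennedyLiebShastry1988; arXiv:1211.2778 §2; LSSY2005 App. A).
-/

noncomputable section

open MeasureTheory Filter
open scoped ENNReal NNReal ComplexConjugate

namespace Summit.AtomisticToContinuum.BoseEinsteinCondensation.Cruxes.GDTransfer.Seeded

namespace PlainAlgebra

open Literature.MathematicalPhysics.QuantumManyBody.BoseGas
open Summit.AtomisticToContinuum.BoseEinsteinCondensation.Theorems.GaussianDominationCan.Negative
open Summit.AtomisticToContinuum.BoseEinsteinCondensation.Cruxes.GDTransfer.DysonDressedWitness
open ChordVariation (dir_const_mul)
open Lnss Bare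

variable {m : ℕ} {L : ℝ} {v : ℝ → ℝ≥0∞} {κ A B : ℝ≥0∞}

/-! ## (A1) The plain pair are directions -/

/-- **(A1, up)**: `ζ₊ = N^{-1/2} Σ_i e_n(x_i) P_i g` is a direction for every direction `g` (`L ≠ 0`). [folklore] -/
theorem isDirection_plainUp (hL : L ≠ 0) (n : Fin 3 → ℤ) {g : Config (m + 1) → ℂ} (hg : IsDirection m L g) :
    IsDirection m L (plainUp m L n g) :=
  dir_const_mul (PlainPair.isDirection_upB hL n hg) _

/-- **(A1, down)**: `ζ₋ = N^{-1/2} Σ_i P_i^{(n)} g` is a direction for every direction `g`. [folklore] -/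
theorem isDirection_plainDown (n : Fin 3 → ℤ) {g : Config (m + 1) → ℂ} (hg : IsDirection m L g) :
    IsDirection m L (plainDown m L n g) :=
  dir_const_mul (PlainPair.isDirection_dnB n hg) _

/-- `ζ₊` is `C¹` for `C¹` `g`. [folklore] -/
theorem contDiff_plainUp (n : Fin 3 → ℤ) {g : Config (m + 1) → ℂ} (hg : ContDiff ℝ 1 g) :
    ContDiff ℝ 1 (plainUp m L n g) :=
  contDiff_const.mul (ContDiff.sum fun i _ =>
    (((contDiff_cellWave L n).of_le (mod_cast le_top)).comp (contDiff_apply ℝ Space i)).mul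
      (contDiff_cellAvg i hg))

/-- `ζ₋` is `C¹` for `C¹` `g`. [folklore] -/
theorem contDiff_plainDown (n : Fin 3 → ℤ) {g : Config (m + 1) → ℂ} (hg : ContDiff ℝ 1 g) :
    ContDiff ℝ 1 (plainDown m L n g) :=
  contDiff_const.mul (ContDiff.sum fun i _ => contDiff_fourierAvg n i hg)

/-! ## (A2) Budgets of the plain pair -/

/-- `|N^{-1/2}|² ≤ 1` (read in `ℝ≥0∞`). [folklore] -/
theorem nnnorm_sq_invSqrt_le_one (m : ℕ) :
    ((‖((Real.sqrt ((m + 1 : ℕ) : ℝ))⁻¹ : ℂ)‖₊ : ℝ≥0∞)) ^ 2 ≤ 1 := by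
  have h := nnnorm_sq_coef_le_one (n := m) (Finset.univ : Finset (Fin (m + 1)))
  rwa [Finset.card_univ, Fintype.card_fin] at h

/-- **Budget of `ζ₊ = N^{-1/2} a_p†a₀ g`**: `Φ(ζ₊) ≤ 2^N·N·(2 + 6N(2π/L)²)(1 + κ)·Φ(g)` provided `A ≤ B`,
`A‖p‖² ≤ B`. [folklore] -/
theorem budget_plainUp_le (hL : 0 < L) (hv : Measurable v)
    (hκ : ((m + 1 : ℕ) : ℝ≥0∞) ^ 2 * ((ENNReal.ofReal (L ^ 3))⁻¹ * ∫⁻ x : Space, v ‖x‖) ≤ κ)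
    (hAB : A ≤ B) (p : Fin 3 → ℤ) (hq : A * ENNReal.ofReal (‖(fun j => (p j : ℝ))‖ ^ 2) ≤ B)
    {g : Config (m + 1) → ℂ} (hg : ContDiff ℝ 1 g) :
    A * eform v L (plainUp m L p g) + B * mass L (plainUp m L p g) ≤
      2 ^ (m + 1) * (((m + 1 : ℕ) : ℝ≥0∞) *
        ((2 + 6 * (((m + 1 : ℕ) : ℝ≥0∞) * ENNReal.ofReal ((2 * Real.pi / L) ^ 2))) * ((1 + κ) *
          (A * eform v L g + B * mass L g)))) := by
  have hP : ∀ i : Fin (m + 1), ContDiff ℝ 1 (cellAvg (m + 1) L i g) := fun i => contDiff_cellAvg i hg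
  have hterm : ∀ i ∈ (Finset.univ : Finset (Fin (m + 1))), ContDiff ℝ 1 fun X : Config (m + 1) =>
      cellWave L p (X i) * cellAvg (m + 1) L i g X := fun i _ =>
    (((contDiff_cellWave L p).of_le (mod_cast le_top)).comp (contDiff_apply ℝ Space i)).mul (hP i)
  have hsum : ContDiff ℝ 1 fun X : Config (m + 1) =>
      ∑ i : Fin (m + 1), cellWave L p (X i) * cellAvg (m + 1) L i g X := ContDiff.sum hterm
  unfold plainUp
  calc A * eform v L (fun X => ((Real.sqrt ((m + 1 : ℕ) : ℝ))⁻¹ : ℂ) *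
          ∑ i : Fin (m + 1), cellWave L p (X i) * cellAvg (m + 1) L i g X) +
        B * mass L (fun X => ((Real.sqrt ((m + 1 : ℕ) : ℝ))⁻¹ : ℂ) *
          ∑ i : Fin (m + 1), cellWave L p (X i) * cellAvg (m + 1) L i g X)
      ≤ A * eform v L (fun X => ∑ i : Fin (m + 1), cellWave L p (X i) * cellAvg (m + 1) L i g X) +
          B * mass L (fun X => ∑ i : Fin (m + 1), cellWave L p (X i) * cellAvg (m + 1) L i g X) :=
        budget_smul_le v (nnnorm_sq_invSqrt_le_one m) hsum
    _ ≤ 2 ^ (Finset.univ : Finset (Fin (m + 1))).card * ∑ i : Fin (m + 1),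
          (A * eform v L (fun X => cellWave L p (X i) * cellAvg (m + 1) L i g X) +
            B * mass L (fun X => cellWave L p (X i) * cellAvg (m + 1) L i g X)) :=
        budget_finset_sum_le hv Finset.univ hterm
    _ ≤ 2 ^ (Finset.univ : Finset (Fin (m + 1))).card * ∑ _i : Fin (m + 1),
          ((2 + 6 * (((m + 1 : ℕ) : ℝ≥0∞) * ENNReal.ofReal ((2 * Real.pi / L) ^ 2))) * ((1 + κ) *
            (A * eform v L g + B * mass L g))) := by
        refine mul_le_mul' le_rfl (Finset.sum_le_sum fun i _ => ?_)
        exact (budget_phase_le hL hv p i hq (hP i)).trans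
          (mul_le_mul' le_rfl (budget_cellAvg_le hL hv hκ hAB i hg))
    _ = _ := by
        rw [Finset.sum_const, Finset.card_univ, Fintype.card_fin, nsmul_eq_mul]

/-- **Budget of `ζ₋ = N^{-1/2} a₀†a_p g`**: `Φ(ζ₋) ≤ 2^N·N·(1 + κ)(2 + 6N(2π/L)²)·Φ(g)` provided `A ≤ B`,
`A‖p‖² ≤ B`. [folklore] -/
theorem budget_plainDown_le (hL : 0 < L) (hv : Measurable v)
    (hκ : ((m + 1 : ℕ) : ℝ≥0∞) ^ 2 * ((ENNReal.ofReal (L ^ 3))⁻¹ * ∫⁻ x : Space, v ‖x‖) ≤ κ)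
    (hAB : A ≤ B) (p : Fin 3 → ℤ) (hq : A * ENNReal.ofReal (‖(fun j => (p j : ℝ))‖ ^ 2) ≤ B)
    {g : Config (m + 1) → ℂ} (hg : ContDiff ℝ 1 g) :
    A * eform v L (plainDown m L p g) + B * mass L (plainDown m L p g) ≤
      2 ^ (m + 1) * (((m + 1 : ℕ) : ℝ≥0∞) * ((1 + κ) *
        ((2 + 6 * (((m + 1 : ℕ) : ℝ≥0∞) * ENNReal.ofReal ((2 * Real.pi / L) ^ 2))) *
          (A * eform v L g + B * mass L g)))) := by
  have hsum : ContDiff ℝ 1 fun X : Config (m + 1) => ∑ i : Fin (m + 1), fourierAvg m L p i g X :=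
    ContDiff.sum fun i _ => contDiff_fourierAvg p i hg
  unfold plainDown
  exact (budget_smul_le v (nnnorm_sq_invSqrt_le_one m) hsum).trans
    (budget_sum_fourierAvg_le hL hv hκ hAB p hq hg)

/-- **A-priori bounds of the plain pair**: for integrable `v` and `L > 0` there is a finite `C = C(v, N, L)` with
`‖ζ±‖² ≤ C‖g‖²` and `𝓔(ζ±) ≤ C(𝓔(g) + (1 + ‖p‖²)‖g‖²)` for every mode `p` and every `C¹` `g`. [folklore] -/
theorem exists_apriori_const (hL : 0 < L) (hv : Measurable v) (hint : (∫⁻ x : Space, v ‖x‖) ≠ ⊤)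
    (m : ℕ) :
    ∃ C : ℝ≥0∞, C ≠ ⊤ ∧ ∀ (p : Fin 3 → ℤ) (g : Config (m + 1) → ℂ), ContDiff ℝ 1 g →
      mass L (plainUp m L p g) ≤ C * mass L g ∧ mass L (plainDown m L p g) ≤ C * mass L g ∧
      eform v L (plainUp m L p g) ≤
        C * (eform v L g + (1 + ENNReal.ofReal (‖(fun j => (p j : ℝ))‖ ^ 2)) * mass L g) ∧
      eform v L (plainDown m L p g) ≤
        C * (eform v L g + (1 + ENNReal.ofReal (‖(fun j => (p j : ℝ))‖ ^ 2)) * mass L g) := by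
  -- adapted from `Bare.exists_apriori_const`
  set κ : ℝ≥0∞ := ((m + 1 : ℕ) : ℝ≥0∞) ^ 2 * ((ENNReal.ofReal (L ^ 3))⁻¹ * ∫⁻ x : Space, v ‖x‖)
    with hκdef
  have hκ : ((m + 1 : ℕ) : ℝ≥0∞) ^ 2 * ((ENNReal.ofReal (L ^ 3))⁻¹ * ∫⁻ x : Space, v ‖x‖) ≤ κ :=
    le_rfl
  have hκtop : κ ≠ ⊤ := by
    refine ENNReal.mul_ne_top (ENNReal.pow_ne_top (ENNReal.natCast_ne_top _))
      (ENNReal.mul_ne_top (ENNReal.inv_ne_top.2 ?_) hint)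
    exact (ENNReal.ofReal_pos.2 (by positivity)).ne'
  set D : ℝ≥0∞ := 2 + 6 * (((m + 1 : ℕ) : ℝ≥0∞) * ENNReal.ofReal ((2 * Real.pi / L) ^ 2)) with hD
  have hDtop : D ≠ ⊤ :=
    ENNReal.add_ne_top.2 ⟨ENNReal.ofNat_ne_top, ENNReal.mul_ne_top ENNReal.ofNat_ne_top
      (ENNReal.mul_ne_top (ENNReal.natCast_ne_top _) ENNReal.ofReal_ne_top)⟩
  set C : ℝ≥0∞ := 2 ^ (m + 1) * (((m + 1 : ℕ) : ℝ≥0∞) * ((1 + κ) * D)) with hC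
  have hCtop : C ≠ ⊤ :=
    ENNReal.mul_ne_top (ENNReal.pow_ne_top ENNReal.ofNat_ne_top)
      (ENNReal.mul_ne_top (ENNReal.natCast_ne_top _)
        (ENNReal.mul_ne_top (ENNReal.add_ne_top.2 ⟨ENNReal.one_ne_top, hκtop⟩) hDtop))
  refine ⟨C, hCtop, fun p g hg => ?_⟩
  set q : ℝ≥0∞ := ENNReal.ofReal (‖(fun j => (p j : ℝ))‖ ^ 2) with hq
  -- budgets at `(A, B) = (0, 1)` and `(1, 1 + q)`
  have h0q : (0 : ℝ≥0∞) * q ≤ 1 := by rw [zero_mul]; exact zero_le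
  have h1q : (1 : ℝ≥0∞) * q ≤ 1 + q := by rw [one_mul]; exact le_add_self
  have hU0 := budget_plainUp_le hL hv hκ (zero_le (a := (1 : ℝ≥0∞))) p h0q hg
  have hL0 := budget_plainDown_le hL hv hκ (zero_le (a := (1 : ℝ≥0∞))) p h0q hg
  have hU1 := budget_plainUp_le hL hv hκ (le_self_add (a := (1 : ℝ≥0∞)) (b := q)) p h1q hg
  have hL1 := budget_plainDown_le hL hv hκ (le_self_add (a := (1 : ℝ≥0∞)) (b := q)) p h1q hg
  simp only [zero_mul, zero_add, one_mul] at hU0 hL0 hU1 hL1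
  refine ⟨hU0.trans (le_of_eq ?_), hL0.trans (le_of_eq ?_),
    le_self_add.trans (hU1.trans (le_of_eq ?_)), le_self_add.trans (hL1.trans (le_of_eq ?_))⟩ <;>
    simp only [hC, hD] <;> ring

end PlainAlgebra

open Literature.MathematicalPhysics.QuantumManyBody.BoseGas in
open Summit.AtomisticToContinuum.BoseEinsteinCondensation.Cruxes.GDTransfer.DysonDressedWitness in
/-- **Part 1 of `stub_plainPairAlgebra` (registered helper statement)**: (A1) the plain pair `ζ₊ = plainUp n Ψ`,
`ζ₋ = plainDown n Ψ` are directions and (A2) for a finite continuous repulsive profile, at every `(N, L)` one radius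
`R₀` bounds their masses and, with the factor `(1 + ‖n‖²)(E(Ψ) + 1)`, their energy forms, for every mode `n` and
every periodic trial state `Ψ`. [folklore] (KennedyLiebShastry1988; arXiv:1211.2778 §2; LSSY2005 App. A) -/
theorem plainPair_apriori :
    ∀ v : ℝ → ENNReal, Literature.MathematicalPhysics.QuantumManyBody.BoseGas.IsRepulsiveFiniteRange v →
      IsFiniteContinuous v → ∀ (m : ℕ) (L : ℝ), 0 < L → ∃ R₀ : ℝ, 0 < R₀ ∧
        ∀ (n : Fin 3 → ℤ) (Ψ : Literature.MathematicalPhysics.QuantumManyBody.BoseGas.PeriodicTrialState (m + 1) L),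
          Summit.AtomisticToContinuum.BoseEinsteinCondensation.Cruxes.GDTransfer.DysonDressedWitness.IsDirection m L
              (plainUp m L n Ψ.ψ) ∧
          Summit.AtomisticToContinuum.BoseEinsteinCondensation.Cruxes.GDTransfer.DysonDressedWitness.IsDirection m L
              (plainDown m L n Ψ.ψ) ∧
          Summit.AtomisticToContinuum.BoseEinsteinCondensation.Cruxes.GDTransfer.DysonDressedWitness.mass L
              (plainUp m L n Ψ.ψ) ≤ ENNReal.ofReal R₀ ∧
          Summit.AtomisticToContinuum.BoseEinsteinCondensation.Cruxes.GDTransfer.DysonDressedWitness.mass L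
              (plainDown m L n Ψ.ψ) ≤ ENNReal.ofReal R₀ ∧
          Summit.AtomisticToContinuum.BoseEinsteinCondensation.Cruxes.GDTransfer.DysonDressedWitness.eform v L
              (plainUp m L n Ψ.ψ) ≤
            ENNReal.ofReal (R₀ * (1 + ‖(fun j => (n j : ℝ))‖ ^ 2)) *
              (Literature.MathematicalPhysics.QuantumManyBody.BoseGas.periodicEnergy v Ψ + 1) ∧
          Summit.AtomisticToContinuum.BoseEinsteinCondensation.Cruxes.GDTransfer.DysonDressedWitness.eform v L
              (plainDown m L n Ψ.ψ) ≤
            ENNReal.ofReal (R₀ * (1 + ‖(fun j => (n j : ℝ))‖ ^ 2)) *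
              (Literature.MathematicalPhysics.QuantumManyBody.BoseGas.periodicEnergy v Ψ + 1) := by
  -- adapted from `stub_bareAdmissible`
  intro v hv hfc m L hL
  obtain ⟨C, hCtop, hC⟩ := PlainAlgebra.exists_apriori_const (L := L) hL hv.1
    (lintegral_ne_top_of_isFiniteContinuous hv hfc) m
  refine ⟨C.toReal + 1, by positivity, fun p Ψ => ?_⟩
  obtain ⟨h1, h2, h3, h4⟩ := hC p Ψ.ψ Ψ.contDiff
  rw [mass_trialState Ψ, mul_one] at h1 h2 h3 h4
  rw [eform_trialState v Ψ] at h3 h4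
  have hCle : C ≤ ENNReal.ofReal (C.toReal + 1) := by
    rw [ENNReal.ofReal_add ENNReal.toReal_nonneg zero_le_one, ENNReal.ofReal_toReal hCtop]
    exact le_self_add
  have hform : ∀ {e : ℝ≥0∞},
      e ≤ C * (periodicEnergy v Ψ + (1 + ENNReal.ofReal (‖(fun j => (p j : ℝ))‖ ^ 2))) →
        e ≤ ENNReal.ofReal ((C.toReal + 1) * (1 + ‖(fun j => (p j : ℝ))‖ ^ 2)) *
          (periodicEnergy v Ψ + 1) := by
    intro e he
    refine he.trans ?_
    rw [ENNReal.ofReal_mul (by positivity), ENNReal.ofReal_add zero_le_one (sq_nonneg _),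
      ENNReal.ofReal_one, mul_assoc]
    refine mul_le_mul' hCle ?_
    rw [mul_add, mul_one]
    refine add_le_add ?_ le_rfl
    calc periodicEnergy v Ψ = 1 * periodicEnergy v Ψ := (one_mul _).symm
      _ ≤ (1 + ENNReal.ofReal (‖(fun j => (p j : ℝ))‖ ^ 2)) * periodicEnergy v Ψ :=
          mul_le_mul' le_self_add le_rfl
  exact ⟨PlainAlgebra.isDirection_plainUp hL.ne' p (isDirection_trialState Ψ),
    PlainAlgebra.isDirection_plainDown p (isDirection_trialState Ψ),
    h1.trans hCle, h2.trans hCle, hform h3, hform h4⟩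

end Summit.AtomisticToContinuum.BoseEinsteinCondensation.Cruxes.GDTransfer.Seeded

end
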